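import Summits.BirchSwinnertonDyer.Rank1Residual.X11b.KolyvaginTauEigenConcrete
import Summits.BirchSwinnertonDyer.Rank1Residual.X11b.RingClassFieldNoTorsionOfIrreducible
import Summits.BirchSwinnertonDyer.Rank1Residual.X11b.Three.HeegnerDiscriminantBound
import Literature.NumberTheory.GaloisRepresentations.DecomposedGenericInfinite
import Literature.NumberTheory.EllipticCurves.WeilPairingProofs
import HarnessLib

/-!
# Gross 1991 Prop. 5.4 (1) for the CONCRETE derived points AT `p = 3` (`3 ∣ N`): clause (d) of leaf
# (A′) at concrete currency, `hD` discharged, `hA` supplied on both image cells — the x11b3-side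
# COMPOSITION (team N8/O2, seat x11b3-p8 GEN 12, lead GEN 11 R12-7 (5))

Summit-side THEOREM-ONLY file (no definition, no named fact, no `sorry`); `K : Type`.  Cell
`b2b-bsdres`, team x11b3, leaf (A′) register (R11-4 / R11-6 / R12-8), clause (d) (`τ P(m) ≡ ε_m P(m)`):
composition home of the concrete chain at `p = 3` (as `Three/KolyvaginH44AtThree` is for clause (f)
`h44` and `Three/KolyvaginHlocAtThree` for clause (e) `hloc`).

HONEST FRAMING (cell `b2b-bsdres`, verbatim): this cell deletes COMBINATION-shaped residual classes
from published theorems only; the CONSTRUCTION-shaped remainder is typed, not attempted; census output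
is EVIDENCE, never a Literature fact; `X11 ∧ r = 1 ∧ p = 3` stays CONSTRUCTION-SHAPED; O2 OPEN / N8
CONSTRUCTION; this is not "finishing BSD".  HONEST FRAMING (H47 lineage, binding, this file):
**plumbing at concrete currency** — the three ENDs below compose x11b3-p2's landed concrete END
`KolyvaginTauEigen.pointsMap_derivedPoint_concrete_of_prop53` (`X11b/KolyvaginTauEigenConcrete`) at
`p := 3`; on ALL of X11b @ 3 (both image cells) clause (d) of the `hpoints` binder of
`KolyvaginDescent.Kolyvagin1990_sha_primary_finite_of_pointsM_of_reciprocityM` (Gross 1991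
Prop. 5.4 (1), `τ P(m) = ε (−1)^{f_m} P(m) + 3^M B`) for the CONCRETE derived points is thereby a
tree theorem CONDITIONAL on (A′-53) = Gross Prop. 5.3 at conductor `m` in its printed form (the
labelled binder `h53`, cite-only, NOT a Literature fact, NOT attempted) + one image binder +
structural data; `hD : d_K < -4` is RECOVERED from `hND` + `3 ∣ N` + the orientation; `ε : ℤ` is free
(Gross (5.2): `ε` = the `w_N`-eigenvalue, sign `(E/ℚ) = −ε` — stated, not used); `JET@p∣N`, (γ),
[GZ86 III (3.1)], `h37` / `h44` / `hpoints` on the residual map, (A′-53), (A′-glob), (R)_M are NOT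
discharged; the finiteness theorem also carries `hexc` + `hK1`; the node `Three.HsiehDescentAt₃` and
the open content (t) are unchanged; nothing is booked; no mark / label / count / tier moves.

## The composition (three theorems)

* `Three.pointsMap_derivedPoint_concrete_at_three_of_prop53` — p2's END at `p := 3`,
  `hp := Nat.prime_three`, with
  `hD := Three.discr_lt_neg_four_of_isCoprime_of_dvd_sq_sub hK hND h3 (d n dvd_rfl).dvd_sq_sub`
  (`X11b/Three/HeegnerDiscriminantBound`: at `3 ∣ N`, `(N, d_K) = 1` and `β² ≡ d_K (mod 4N)` force
  `d_K ≡ 1 (mod 3)`, so `d_K ∉ {-3, -4}`); the ONLY new binder is `h3 : 3 ∣ N` (replacing `hD`); every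
  other binder VERBATIM in p2's order (`hK ι hM Dt hND h3 hn hKol d hc hτ ε h53 hA`); remaining
  labelled binders EXACTLY {`h53`} + `hA`.
* `Three.pointsMap_derivedPoint_concrete_at_three_of_prop53_of_surj_three` — `hA` REPLACED by the
  class-record binder `Surj W 3`, supplied by x11b3-p3's
  `RingClassNoTorsion.isAdmissible_pointsSubgroup_of_dvd` (`X11b/RingClassFieldNoTorsion`; Gross
  Lemma 4.3 / McCallum (5) from surjectivity); remaining EXACTLY {`h53`} + `Surj W 3` (the same cell as
  p2's `…_of_surj`, phrased on the class-record abbreviation `Surj W 3`).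
* `Three.pointsMap_derivedPoint_concrete_at_three_of_prop53_of_irreducible` — `hA` REPLACED by the
  class-record binder `W.HasIrreducibleModPGaloisRep 3`, supplied by x11b3-p4's
  `NoTorsionIrr.isAdmissible_pointsSubgroup_of_hasIrreducibleModPGaloisRep_of_dvd`
  (`X11b/RingClassFieldNoTorsionOfIrreducible`; Lemma 4.3 WITHOUT surjectivity: irreducibility + Weil
  pairing + `3` unramified in `K` + `3 ∤ n`), its side inputs DISCHARGED in-file: the Weil pairing by
  the tree's theorem `WeierstrassCurve.exists_weilPairing_holds` (`Literature/…/WeilPairingProofs`),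
  `3` unramified in `K` from `3 ∤ d_K` (`hND` + `h3`; Mathlib `NumberField.not_dvd_discr_iff_isUnramifiedIn`
  + the tree's `isUnramifiedIn_of_isUnramifiedIn_span`, route (α) of x11b3-p2 GEN 9 / R10-62 (2)),
  `3 ∤ n` from the Kolyvagin-prime clause `q ≠ 3`; remaining EXACTLY {`h53`} +
  `HasIrreducibleModPGaloisRep 3` — the X11b @ 3 class binder (`E[3]` irreducible, surjective or not).

## References
* [GrossLMS1991] B. H. Gross, *Kolyvagin's work on modular elliptic curves*, LMS LNS 153 (1991), §1
  ("we assume that `D ≠ 3, 4`"), §3 (3.1)–(3.3) and `τστ⁻¹ = σ⁻¹`, Lemma 4.3, §4 (4.1), §5 (5.2),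
  Prop. 5.3, Prop. 5.4 (1) and proof (held `book:editornd-l-functions-arithmetic`, chunks 216–221;
  Prop. 5.3 = chunk 220 L11, proof of 5.4 (1) = chunk 220 L23 – chunk 221 L7).
* [McCallumLMS1991] W. G. McCallum, *Kolyvagin's work on Shafarevich–Tate groups*, same volume, §4
  (4)–(5), Lemma 4.3.
* [Cox2013] D. A. Cox, *Primes of the form x² + ny²*, 2nd ed., §9.A Lemma 9.3 (the dihedral law,
  consumed through p2's END).

## Mathlib / tree search
Tree: `KolyvaginTauEigen.pointsMap_derivedPoint_concrete_of_prop53[_of_surj]` (x11b3-p2, (P2-TAU-D));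
`Three.discr_lt_neg_four_of_isCoprime_of_dvd_sq_sub` (p292135);
`RingClassNoTorsion.isAdmissible_pointsSubgroup_of_dvd` (p293267);
`NoTorsionIrr.isAdmissible_pointsSubgroup_of_hasIrreducibleModPGaloisRep_of_dvd` (p296025);
`WeierstrassCurve.exists_weilPairing_holds`; `isUnramifiedIn_of_isUnramifiedIn_span`.  Mathlib:
`NumberField.not_dvd_discr_iff_isUnramifiedIn`, `IsCoprime.isUnit_of_dvd'`.  `lean search
'concrete_at_three_of_prop53'` → no matches (INTENT-grep).
-/

noncomputable section

open scoped Classical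
open WeierstrassCurve Field NumberField IsDedekindDomain Finset
open Literature.NumberTheory.EllipticCurves Literature.NumberTheory.GaloisRepresentations
open Literature.NumberTheory.EllipticCurves.KolyvaginCocycle
open Literature.NumberTheory.EllipticCurves.RingClassField
open Literature.NumberTheory.EllipticCurves.ModularForms

namespace Summit.BirchSwinnertonDyer.Rank1Residual.X11b.Three

variable {K : Type} [Field K] [NumberField K] {N : ℕ} {W : WeierstrassCurve ℚ}

/-- **Gross 1991, Prop. 5.4 (1) for the CONCRETE derived points `P(m) = (d m).derivedPoint` AT
`p = 3`, modulo Prop. 5.3 (A′-53), `hD` discharged** (x11b3-p2's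
`KolyvaginTauEigen.pointsMap_derivedPoint_concrete_of_prop53` specialised to `p := 3`).  For `K`
imaginary quadratic with `ι : K → ℂ`, `E = W/ℚ` globally minimal with a modular parametrisation `Dt`
of level `N` prime to `d_K` (`hND`) and divisible by `3` (`h3`), `M ≥ 1`, a square-free level `n` of
Kolyvagin primes for `p = 3` with `Frob = Frob_∞` on `K(E[3^M])` (`hKol`, Gross (3.1)–(3.3)), ANY
Kolyvagin–Heegner data `d m` at the divisors of `n`, the non-trivial automorphism `c` of `K` and ANY
lift `τ` of `c` to `K̄` (`hτ`), `ε : ℤ` (free), and the LABELLED inputs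
* `h53` = **Gross Prop. 5.3 at conductor `m` (A′-53), printed form** (*"We have
  `y_n^τ = ε · y_n^{σ'} +` (torsion) in `E(K_n)`, for some `σ' ∈ 𝒢_n`"*): for every `m ∣ n` and the
  automorphism `τ_m` of `K[m]` acting as complex conjugation, some `σ' ∈ 𝒢_m` has
  `τ_m y(m) − ε • σ' y(m)` of finite order — OPEN LEAF, cite-only, NOT a Literature fact, NOT
  discharged (p2's binder VERBATIM);
* `hA` = Gross Lemma 4.3 / McCallum (5): `E(K[m]) ⊆ E(K̄)` admissible for `3^M` (`m ∣ n`);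
the concrete derived point satisfies, for all `m ∣ n`:
`∃ B ∈ E(K[m]), τ · P(m) = (ε · (−1)^{f_m}) • P(m) + 3^M • B` in `E(K̄)` — clause (d) of the `hpoints`
binder of `KolyvaginDescent.Kolyvagin1990_sha_primary_finite_of_pointsM_of_reciprocityM` at
`A m := (d m).pointsSubgroup`, `Pt m := (d m).toGeomPoints (d m).derivedPoint`, `p := 3`.  The binder
`hD : d_K < -4` of the general-`p` END is DISCHARGED from `hND` + `h3` + the orientation
`β² ≡ d_K (mod 4N)` carried by `d n` (`Three.discr_lt_neg_four_of_isCoprime_of_dvd_sq_sub`).  WORDING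
OF RECORD: plumbing at concrete currency; CONDITIONAL on (A′-53) in printed form (`h53`, cite-only,
NOT a fact) + `hA` + structural; `JET@p∣N` / (γ) / [GZ86 III (3.1)] / `h44` / `hpoints` / (A′-glob) /
(R)_M NOT discharged; nothing booked.
[cite: GrossLMS1991, §5 Prop. 5.4 (1) and proof, Prop. 5.3, (5.2), §1 (D ≠ 3, 4), §3, Lemma 4.3, §4 (4.1)]
[cite: McCallumLMS1991, §4 (4)–(5), Lemma 4.3] [cite: Cox2013, §9.A Lemma 9.3] -/
theorem pointsMap_derivedPoint_concrete_at_three_of_prop53 [NeZero N] [W.IsElliptic]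
    [W.IsGloballyMinimal] (hK : IsImaginaryQuadratic K) (ι : K →+* ℂ) {M : ℕ} (hM : 1 ≤ M)
    (Dt : ModularParametrizationData W N) {β : ℤ}
    (hND : IsCoprime (N : ℤ) (NumberField.discr K)) (h3 : 3 ∣ N)
    {n : ℕ} (hn : Squarefree n)
    (hKol : ∀ q ∈ n.primeFactors, IsKolyvaginPrime N W K 3 q ∧ FrobEqFrobInfty W K (3 ^ M) q)
    (d : (m : ℕ) → m ∣ n → KolyvaginHeegnerData Dt β ι m)
    {c : K ≃ₐ[ℚ] K} (hc : c ≠ 1) {τ : AlgebraicClosure K ≃+* AlgebraicClosure K}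
    (hτ : IsLiftOfAut c τ) (ε : ℤ)
    (h53 : ∀ (m : ℕ) (hm : m ∣ n) (τm : ringClassField K ι m ≃ₐ[ℚ] ringClassField K ι m),
      (∀ x : ringClassField K ι m, ((τm x : ringClassField K ι m) : ℂ) = starRingEnd ℂ x) →
      ∃ σ' ∈ ringClassGal ι m, IsOfFinAddOrder
        (pointGalHom W (ringClassField K ι m) τm (d m hm).y -
          ε • pointGalHom W (ringClassField K ι m) σ' (d m hm).y))
    (hA : ∀ (m : ℕ) (hm : m ∣ n),
      IsAdmissible (absoluteGaloisGroup K) (d m hm).pointsSubgroup ((3 ^ M : ℕ) : ℤ)) :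
    ∀ (m : ℕ) (hm : m ∣ n), ∃ B ∈ (d m hm).pointsSubgroup,
      hτ.pointsMap W ((d m hm).toGeomPoints (d m hm).derivedPoint) =
        (ε * (-1) ^ m.primeFactors.card) • (d m hm).toGeomPoints (d m hm).derivedPoint +
          ((3 ^ M : ℕ) : ℤ) • B :=
  KolyvaginTauEigen.pointsMap_derivedPoint_concrete_of_prop53 hK ι Nat.prime_three hM Dt hND
    (discr_lt_neg_four_of_isCoprime_of_dvd_sq_sub hK hND h3 (d n dvd_rfl).dvd_sq_sub) hn hKol d hc hτ
    ε h53 hA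

/-- **Gross Prop. 5.4 (1) for the concrete derived points at `p = 3` ON THE SURJECTIVE CELL: `hD`
discharged, `hA` supplied** from the class-record binder `Surj W 3` (`ρ̄_{E,3}` onto `GL₂(𝔽₃)`) by
x11b3-p3's `RingClassNoTorsion.isAdmissible_pointsSubgroup_of_dvd` (`X11b/RingClassFieldNoTorsion`:
Gross Lemma 4.3 / McCallum (5) at the ring class fields `K[m]`, `m ∣ n`) — p2's `…_of_surj` at
`p := 3` on the class-record abbreviation.  Remaining labelled binders EXACTLY {`h53`} + the class
binder `Surj W 3`; WORDING OF RECORD as above; nothing booked.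
[cite: GrossLMS1991, Prop. 5.4 (1), Prop. 5.3, Lemma 4.3, §4 (4.1)] [cite: McCallumLMS1991, §4 (4)–(5)] -/
theorem pointsMap_derivedPoint_concrete_at_three_of_prop53_of_surj_three [NeZero N] [W.IsElliptic]
    [W.IsGloballyMinimal] (hK : IsImaginaryQuadratic K) (ι : K →+* ℂ) {M : ℕ} (hM : 1 ≤ M)
    (Dt : ModularParametrizationData W N) {β : ℤ}
    (hND : IsCoprime (N : ℤ) (NumberField.discr K)) (h3 : 3 ∣ N)
    {n : ℕ} (hn : Squarefree n)
    (hKol : ∀ q ∈ n.primeFactors, IsKolyvaginPrime N W K 3 q ∧ FrobEqFrobInfty W K (3 ^ M) q)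
    (d : (m : ℕ) → m ∣ n → KolyvaginHeegnerData Dt β ι m)
    {c : K ≃ₐ[ℚ] K} (hc : c ≠ 1) {τ : AlgebraicClosure K ≃+* AlgebraicClosure K}
    (hτ : IsLiftOfAut c τ) (ε : ℤ)
    (h53 : ∀ (m : ℕ) (hm : m ∣ n) (τm : ringClassField K ι m ≃ₐ[ℚ] ringClassField K ι m),
      (∀ x : ringClassField K ι m, ((τm x : ringClassField K ι m) : ℂ) = starRingEnd ℂ x) →
      ∃ σ' ∈ ringClassGal ι m, IsOfFinAddOrder
        (pointGalHom W (ringClassField K ι m) τm (d m hm).y -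
          ε • pointGalHom W (ringClassField K ι m) σ' (d m hm).y))
    (hsurj : Rank1Residual.Surj W 3) :
    ∀ (m : ℕ) (hm : m ∣ n), ∃ B ∈ (d m hm).pointsSubgroup,
      hτ.pointsMap W ((d m hm).toGeomPoints (d m hm).derivedPoint) =
        (ε * (-1) ^ m.primeFactors.card) • (d m hm).toGeomPoints (d m hm).derivedPoint +
          ((3 ^ M : ℕ) : ℤ) • B :=
  pointsMap_derivedPoint_concrete_at_three_of_prop53 hK ι hM Dt hND h3 hn hKol d hc hτ ε h53
    (fun m hm ↦ RingClassNoTorsion.isAdmissible_pointsSubgroup_of_dvd hK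
      (Squarefree.ne_zero hn) d Nat.prime_three (by decide) hsurj M m hm)

/-- **Gross Prop. 5.4 (1) for the concrete derived points at `p = 3` ON THE IRREDUCIBLE CELL: `hD`
discharged, `hA` supplied** from the class-record binder `W.HasIrreducibleModPGaloisRep 3` (`E[3]`
irreducible, surjective or not) by x11b3-p4's
`NoTorsionIrr.isAdmissible_pointsSubgroup_of_hasIrreducibleModPGaloisRep_of_dvd`
(`X11b/RingClassFieldNoTorsionOfIrreducible`: Lemma 4.3 without surjectivity, from irreducibility +
the Weil pairing + `3` unramified in `K` + `3 ∤ n`), all three side inputs DISCHARGED here: the Weil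
pairing is the tree's theorem `WeierstrassCurve.exists_weilPairing_holds` (Silverman AEC III.8.1);
`3 ∤ d_K` (`hND` + `h3`) makes `3` unramified in `K` (Dedekind; Mathlib
`NumberField.not_dvd_discr_iff_isUnramifiedIn`, re-based by `isUnramifiedIn_of_isUnramifiedIn_span`);
Kolyvagin primes for `p = 3` are `≠ 3` (Gross (3.1)).  Remaining labelled binders EXACTLY {`h53`} +
the class binder `hirr`; WORDING OF RECORD as above; nothing booked.
[cite: GrossLMS1991, Prop. 5.4 (1), Prop. 5.3, Lemma 4.3, §3 (3.1), §4 (4.1)]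
[cite: McCallumLMS1991, §4 (4)–(5), Lemma 4.3] -/
theorem pointsMap_derivedPoint_concrete_at_three_of_prop53_of_irreducible [NeZero N] [W.IsElliptic]
    [W.IsGloballyMinimal] (hK : IsImaginaryQuadratic K) (ι : K →+* ℂ) {M : ℕ} (hM : 1 ≤ M)
    (Dt : ModularParametrizationData W N) {β : ℤ}
    (hND : IsCoprime (N : ℤ) (NumberField.discr K)) (h3 : 3 ∣ N)
    {n : ℕ} (hn : Squarefree n)
    (hKol : ∀ q ∈ n.primeFactors, IsKolyvaginPrime N W K 3 q ∧ FrobEqFrobInfty W K (3 ^ M) q)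
    (d : (m : ℕ) → m ∣ n → KolyvaginHeegnerData Dt β ι m)
    {c : K ≃ₐ[ℚ] K} (hc : c ≠ 1) {τ : AlgebraicClosure K ≃+* AlgebraicClosure K}
    (hτ : IsLiftOfAut c τ) (ε : ℤ)
    (h53 : ∀ (m : ℕ) (hm : m ∣ n) (τm : ringClassField K ι m ≃ₐ[ℚ] ringClassField K ι m),
      (∀ x : ringClassField K ι m, ((τm x : ringClassField K ι m) : ℂ) = starRingEnd ℂ x) →
      ∃ σ' ∈ ringClassGal ι m, IsOfFinAddOrder
        (pointGalHom W (ringClassField K ι m) τm (d m hm).y -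
          ε • pointGalHom W (ringClassField K ι m) σ' (d m hm).y))
    (hirr : W.HasIrreducibleModPGaloisRep 3) :
    ∀ (m : ℕ) (hm : m ∣ n), ∃ B ∈ (d m hm).pointsSubgroup,
      hτ.pointsMap W ((d m hm).toGeomPoints (d m hm).derivedPoint) =
        (ε * (-1) ^ m.primeFactors.card) • (d m hm).toGeomPoints (d m hm).derivedPoint +
          ((3 ^ M : ℕ) : ℤ) • B := by
  have hn0 : n ≠ 0 := Squarefree.ne_zero hn
  -- the Weil pairing on `E[3]` exists (tree theorem, Silverman AEC III.8.1)
  have hW : W.exists_weilPairing 3 := WeierstrassCurve.exists_weilPairing_holds W 3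
  -- `3 ∤ n`: every prime factor of `n` is a Kolyvagin prime for `p = 3`, hence `≠ 3` (Gross (3.1))
  have hpn : ¬ 3 ∣ n := fun h3n ↦
    (hKol 3 (Nat.mem_primeFactors.mpr ⟨Nat.prime_three, h3n, hn0⟩)).1.2.2.2.1 rfl
  -- `3 ∤ d_K` (`hND` + `h3`), so `3` is unramified in `K` (Dedekind's discriminant theorem)
  have h3N : (3 : ℤ) ∣ (N : ℤ) := by exact_mod_cast h3
  have h3d : ¬ (3 : ℤ) ∣ NumberField.discr K := fun hd ↦ by
    have hu := hND.isUnit_of_dvd' h3N hd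
    rw [Int.isUnit_iff] at hu
    omega
  have hKunr : ∀ v : HeightOneSpectrum (𝓞 ℚ), ((3 : ℕ) : 𝓞 ℚ) ∈ v.asIdeal →
      Algebra.IsUnramifiedIn (𝓞 K) v.asIdeal :=
    isUnramifiedIn_of_isUnramifiedIn_span Nat.prime_three
      ((NumberField.not_dvd_discr_iff_isUnramifiedIn K (𝓞 K)
        (Nat.prime_iff_prime_int.mp Nat.prime_three)).mp (by exact_mod_cast h3d))
  exact pointsMap_derivedPoint_concrete_at_three_of_prop53 hK ι hM Dt hND h3 hn hKol d hc hτ ε h53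
    (fun m hm ↦ NoTorsionIrr.isAdmissible_pointsSubgroup_of_hasIrreducibleModPGaloisRep_of_dvd hK
      hn0 d Nat.prime_three (by decide) hirr hW hKunr hpn M m hm)

end Summit.BirchSwinnertonDyer.Rank1Residual.X11b.Three

end
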